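import Summits.ResolutionOfSingularities.ResolutionOfSingularities.Theorems.MarkedTransferCampaignG1PnegaInterfaceV4Cells
import HarnessLib

/-!
# [OURS · L1 G1 ℘nega-INTERFACE V4 · diagnostic inhabitant #2] The «RADICAL WITNESS»: on `Campaign.PnegaInterfaceV4` (p495141) the cell
# F7c `NonVanishing` — and even F6c `OStable` ∧ F7c — IS SATISFIABLE at the EMPTY provenance (res-ref-a7's lane-A annotation (n1) on
# OURS-DESK #100, 2026-08-27T04:24:12Z, put in the kernel by the typer res-L1-type-o2 g6 as a B6-type regression witness)

WHY. On V3 (p487629) F7c was identically ✗ (`PnegaInterfaceV3.not_nonVanishing_affineLine`, p492822): F3⁻ was a field. res-D-plan-1's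
rev 0.7 = V4 moved F3⁻ out of the structure precisely so that F7c discriminates. This file CONFIRMS that design point in the kernel with the
cheapest inhabitant carrying non-zero negative pieces: at a placement `(B, P)` put
`tilde P i := P i (i > 0) · ⊤ (i = 0) · √(P 1) (i < 0)` (and `⊥` below zero when `P 1 = ⊤`, i.e. when the filtration is trivial).
All eleven fields hold (F2 because every piece is an ideal and `P` is antitone; F8⁻ because the negative pieces are constant; F9 because a
radical is root-closed; F7b-unit because a unit in `√(P 1)` forces `P 1 = ⊤`; F1/F4/F6a vacuously at the EMPTY provenance), and at every
(37)-placement `g ∈ P q ⊆ P 1 ⊆ √(P 1) = tilde P (−1)` with `g ≠ 0` — so `NonVanishing` HOLDS. The witness is `O`-stable (F6c ✓), fails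
F6d-elt `NormDemand e` for `p^e ≥ 2` (by the V4 headline `not_nonVanishing_of_normDemand`) and fails F3⁻ `DiffStableNeg`
(`not_diffStableNeg_of_nonVanishing`, V4Cells p495576). READ-OUT for the scorers: over V4 the pair (F6c ✓ ∧ F7c ✓) is CONSISTENT at the
empty provenance; what excludes candidates is F6d (norm demand) and — untested here by construction — the PROVENANCE fields F1 (transform
law (59)), F4 (completion), F6a (`⊆ I(Sing)`); «V4 ∧ NonVanishing at a NON-EMPTY provenance?» stays the open question (V4 docstring).
Nobody's candidate for the manuscript's `℘nega`: `√(℘(E,1))` in every negative degree is a DIAGNOSTIC value only.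

HONEST FRAMING. Nothing here is a statement of H. Hironaka's manuscript *Resolution of singularities in positive characteristics*
(2017-03-23, [Hironaka2017], lit key `paper:url-3343fd9e678b`); `PnegaInterfaceV4` is OURS (res-D-plan-1's scoring checklist) and this
file exhibits a second diagnostic inhabitant of it, asserting nothing about any printed item [claim: Hironaka2017, status: under-review].
[OURS · L1 G1] replaces the role of: nothing printed — a satisfiability witness; NOT a statement of the manuscript. AI typing weaker than
expert review; nothing here is progress on resolution of singularities in positive characteristic; no claim beyond the kernel.
-/
noncomputable section

set_option linter.dupNamespace false -- mandated namespace of this single-conjunct summit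

namespace Summit.ResolutionOfSingularities.ResolutionOfSingularities.Theorems.Campaign

open Literature.AlgebraicGeometry.Resolution

universe u v

namespace PnegaInterfaceV4

open PnegaInterfaceV3 (emptyProvenance)

section RadWitness

variable {K : Type u} [CommRing K]

/-- The negative pieces of the radical witness: `√(P 1)`, or `⊥` when the filtration is trivial (`P 1 = ⊤`). [folklore] -/
def radNeg {B : Type v} [CommRing B] (P : ℕ → Ideal B) : Ideal B :=
  if P 1 = ⊤ then ⊥ else (P 1).radical

/-- The radical witness as a family of IDEALS: `P i` above zero, `⊤` in degree zero, `radNeg P` below zero. [folklore] -/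
def radTildeIdeal {B : Type v} [CommRing B] (P : ℕ → Ideal B) (i : ℤ) : Ideal B :=
  if 0 < i then P i.toNat else if i = 0 then ⊤ else radNeg P

/-- The radical witness value (additive subgroups of the ideals `radTildeIdeal P i`). [folklore] -/
def radTilde {B : Type v} [CommRing B] (P : ℕ → Ideal B) (i : ℤ) : AddSubgroup B :=
  (radTildeIdeal P i).toAddSubgroup

/-- Membership unfolding. [folklore] -/
theorem mem_radTilde_iff {B : Type v} [CommRing B] (P : ℕ → Ideal B) (i : ℤ) (x : B) :
    x ∈ radTilde P i ↔ x ∈ radTildeIdeal P i := Iff.rfl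

/-- Positive degrees: `P i`. [folklore] -/
theorem radTildeIdeal_of_pos {B : Type v} [CommRing B] (P : ℕ → Ideal B) {i : ℤ} (hi : 0 < i) :
    radTildeIdeal P i = P i.toNat := by simp [radTildeIdeal, hi]

/-- Degree zero: `⊤`. [folklore] -/
theorem radTildeIdeal_zero {B : Type v} [CommRing B] (P : ℕ → Ideal B) : radTildeIdeal P 0 = ⊤ := by
  simp [radTildeIdeal]

/-- Negative degrees: `radNeg P` (constant). [folklore] -/
theorem radTildeIdeal_of_neg {B : Type v} [CommRing B] (P : ℕ → Ideal B) {i : ℤ} (hi : i < 0) :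
    radTildeIdeal P i = radNeg P := by
  have h1 : ¬ 0 < i := by omega
  have h2 : i ≠ 0 := by omega
  simp [radTildeIdeal, h1, h2]

/-- A guarded filtration with `P 1 = ⊤` is trivial: every `P n = ⊤` (multiplicativity). [folklore] -/
theorem eq_top_of_one_eq_top {B : Type v} [CommRing B] [Algebra K B] {P : ℕ → Ideal B} (hP : IsCharFiltration K P)
    (h1 : P 1 = ⊤) : ∀ n : ℕ, P n = ⊤ := by
  intro n
  induction n with
  | zero => exact hP.1
  | succ n ih =>
    refine top_le_iff.mp ?_
    calc (⊤ : Ideal B) = P n * P 1 := by rw [ih, h1, Ideal.top_mul]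
      _ ≤ P (n + 1) := hP.2.2.1 n 1

/-- `radNeg P` is `√(P 1)` as soon as some `P q ≠ ⊤`. [folklore] -/
theorem radNeg_eq_radical {B : Type v} [CommRing B] [Algebra K B] {P : ℕ → Ideal B} (hP : IsCharFiltration K P) {q : ℕ}
    (hq : P q ≠ ⊤) : radNeg P = (P 1).radical := by
  have h1 : P 1 ≠ ⊤ := fun h => hq (eq_top_of_one_eq_top hP h q)
  simp [radNeg, h1]

/-- [diagnostic · B6-type satisfiability witness #2] **The radical witness inhabits V4 at the empty provenance** (every commutative `K`,
every `p ≥ 1`). Field by field: F2 `pos_eq` by definition; F2 `mul_mem` since all pieces are ideals, `P` is antitone and `√(P 1) ⊇ P i`;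
F8⁻ since the negative pieces are constant; F9 since `√(P 1)` (resp. `⊥` over a reduced ring) is closed under `p`-th roots; F7b-unit since a
unit in `√(P 1)` forces `P 1 = ⊤`, excluded at a (37)-placement; F1/F4/F6a vacuous (empty provenance). NOT a candidate for the manuscript's
`℘nega`. [folklore] -/
def radWitness (K : Type u) [CommRing K] {p : ℕ} (hp : 0 < p) : PnegaInterfaceV4 K p (emptyProvenance.{u, v} K) where
  tilde := fun P i => radTilde P i
  pos_eq := by
    intro B _ _ P _ i hi
    have hi' : (0 : ℤ) < (i : ℤ) := by exact_mod_cast hi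
    simp [radTilde, radTildeIdeal_of_pos P hi']
  mul_mem := by
    intro B _ _ P hP i j a b ha hb
    change a ∈ radTildeIdeal P i at ha
    change b ∈ radTildeIdeal P j at hb
    change a * b ∈ radTildeIdeal P (i + j)
    -- organise by the sign of `i + j`
    rcases lt_trichotomy (i + j) 0 with hij | hij | hij
    · -- target negative: `radNeg P`; one of `i`, `j` is negative or both nonpositive with one negative
      rw [radTildeIdeal_of_neg P hij]
      by_cases hi : i < 0
      · rw [radTildeIdeal_of_neg P hi] at ha
        exact Ideal.mul_mem_right b _ ha
      · have hj : j < 0 := by omega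
        rw [radTildeIdeal_of_neg P hj] at hb
        exact Ideal.mul_mem_left _ a hb
    · rw [hij, radTildeIdeal_zero]; exact Submodule.mem_top
    · -- target positive: then `i > 0` or `j > 0`; the other factor is arbitrary and `P` is antitone
      rw [radTildeIdeal_of_pos P hij]
      by_cases hi : 0 < i
      · rw [radTildeIdeal_of_pos P hi] at ha
        by_cases hj : 0 < j
        · rw [radTildeIdeal_of_pos P hj] at hb
          have hnat : (i + j).toNat = i.toNat + j.toNat := by omega
          rw [hnat]
          exact hP.2.2.1 _ _ (Ideal.mul_mem_mul ha hb)
        · have hle : (i + j).toNat ≤ i.toNat := by omega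
          exact hP.2.1 _ _ hle (Ideal.mul_mem_right b _ ha)
      · have hj : 0 < j := by omega
        rw [radTildeIdeal_of_pos P hj] at hb
        have hle : (i + j).toNat ≤ j.toNat := by omega
        exact hP.2.1 _ _ hle (Ideal.mul_mem_left _ a hb)
  antitone_nonpos := by
    intro B _ _ P _ i j hij hj
    have hi : i < 0 := lt_of_le_of_lt hij hj
    change (radTildeIdeal P j).toAddSubgroup ≤ (radTildeIdeal P i).toAddSubgroup
    exact le_of_eq (by rw [radTildeIdeal_of_neg P hj, radTildeIdeal_of_neg P hi])
  root_closed := by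
    intro B _ _ _ P _ b i hi hb
    change b ^ p ∈ radTildeIdeal P (p * i) at hb
    change b ∈ radTildeIdeal P i
    rcases eq_or_lt_of_le hi with h0 | hneg
    · rw [h0, radTildeIdeal_zero]; trivial
    · have hpi : (p : ℤ) * i < 0 := by
        have : (0 : ℤ) < p := by exact_mod_cast hp
        nlinarith
      rw [radTildeIdeal_of_neg P hpi] at hb
      rw [radTildeIdeal_of_neg P hneg]
      unfold radNeg at hb ⊢
      split_ifs at hb ⊢ with h1
      · have hb0 : b ^ p = 0 := by simpa using hb
        have : b = 0 := IsReduced.eq_zero b ⟨p, hb0⟩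
        simp [this]
      · exact Ideal.mem_radical_of_pow_mem hb
  neg_proper := by
    intro B _ _ P hP q g _ _ _ hPq a ha u hu hmem
    have ha' : (-(a : ℤ)) < 0 := by omega
    change u ∈ radTildeIdeal P (-(a : ℤ)) at hmem
    rw [radTildeIdeal_of_neg P ha', radNeg_eq_radical hP hPq] at hmem
    have h1 : P 1 ≠ ⊤ := fun h => hPq (eq_top_of_one_eq_top hP h q)
    exact h1 (Ideal.radical_eq_top.mp (Ideal.eq_top_of_isUnit_mem _ hmem hu))
  transform_mem := fun _ _ _ _ h => h.elim
  transform_le := fun _ _ _ _ h => h.elim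
  baseChange_mem := fun _ _ _ h => h.elim
  baseChange_le := fun _ _ _ h => h.elim
  neg_le_sing := fun _ _ h => h.elim

/-- The radical witness is `O`-stable (F6c ✓): all its pieces are ideals. [folklore] -/
theorem radWitness_oStable (K : Type u) [CommRing K] {p : ℕ} (hp : 0 < p) : (radWitness.{u, v} K hp).OStable := by
  intro B _ _ P i r x hx
  change x ∈ radTildeIdeal P i at hx
  change r * x ∈ radTildeIdeal P i
  exact Ideal.mul_mem_left _ r hx

/-- **F7c ✓ for the radical witness: `NonVanishing` IS SATISFIABLE on V4** (at the empty provenance, every commutative `K`, every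
`p ≥ 1`). At a (37)-placement `(P, q, g)`: `P q ≠ ⊤` forces `P 1 ≠ ⊤` (`eq_top_of_one_eq_top`), the (37) clause forces `g ≠ 0`
(`Resolution.diffIdeal_bot`), and `g ∈ P q ⊆ P 1 ⊆ √(P 1) = tilde P (−1)`. Contrast V3: `PnegaInterfaceV3.not_nonVanishing_affineLine`
(p492822) — there F3⁻ was a field. [folklore] -/
theorem radWitness_nonVanishing (K : Type u) [CommRing K] {p : ℕ} (hp : 0 < p) : (radWitness.{u, v} K hp).NonVanishing := by
  intro B _ _ P hP q g hq hg h37 hPq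
  refine ⟨1, Nat.one_pos, ?_⟩
  have hg0 : g ≠ 0 := by
    rintro rfl
    have h := h37 1 Nat.one_pos
    rw [pow_one, Ideal.span_singleton_eq_bot.mpr rfl, diffIdeal_bot] at h
    have htop : (⊤ : Ideal B) ≤ P q := by rw [← h]; exact bot_le
    exact hPq (top_le_iff.mp htop)
  intro hbot
  have hmem : g ∈ radTilde P (-1) := by
    change g ∈ radTildeIdeal P (-1)
    rw [radTildeIdeal_of_neg P (by norm_num), radNeg_eq_radical hP hPq]
    exact Ideal.le_radical (hP.2.1 1 q hq hg)
  have : g ∈ (⊥ : AddSubgroup B) := by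
    have h' : radTilde P (-((1 : ℕ) : ℤ)) = ⊥ := hbot
    rw [show (-((1 : ℕ) : ℤ)) = -1 by norm_num] at h'
    rw [h'] at hmem
    exact hmem
  exact hg0 (AddSubgroup.mem_bot.mp this)

/-- [read-out] **On V4 the pair (F6c ✓ ∧ F7c ✓) is CONSISTENT at the empty provenance** — every commutative `K`, every `p ≥ 1`; so what
excludes candidates over V4 is F6d (`not_nonVanishing_of_normDemand`) and the provenance fields F1/F4/F6a, not F7c itself. NOT a statement of
the manuscript. [folklore] -/
theorem exists_oStable_and_nonVanishing (K : Type u) [CommRing K] {p : ℕ} (hp : 0 < p) :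
    ∃ I : PnegaInterfaceV4 K p (emptyProvenance.{u, v} K), I.OStable ∧ I.NonVanishing :=
  ⟨radWitness K hp, radWitness_oStable K hp, radWitness_nonVanishing K hp⟩

/-- The radical witness FAILS F3⁻ `DiffStableNeg` (by `not_diffStableNeg_of_nonVanishing`, V4Cells p495576; base a field, placement in its
universe). [folklore] -/
theorem radWitness_not_diffStableNeg (K : Type u) [Field K] {p : ℕ} (hp : 0 < p) :
    ¬ (radWitness.{u, u} K hp).DiffStableNeg :=
  not_diffStableNeg_of_nonVanishing _ (radWitness_nonVanishing K hp)

/-- The radical witness FAILS F6d-elt `NormDemand e` for every `e` with `p^e ≥ 2` (by the V4 headline `not_nonVanishing_of_normDemand`,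
p495141). [folklore] -/
theorem radWitness_not_normDemand (K : Type u) [Field K] {p : ℕ} (hp : 0 < p) {e : ℕ} (he : 2 ≤ p ^ e) :
    ¬ (radWitness.{u, u} K hp).NormDemand e :=
  not_normDemand_of_nonVanishing _ (radWitness_nonVanishing K hp) he

/-- [read-out, subtype form] Over a field, the F7c-passing inhabitants of V4 at the empty provenance form a NON-EMPTY type (contrast
`PnegaInterfaceV3.isEmpty_subtype_nonVanishing`, p492822). [folklore] -/
theorem nonempty_subtype_nonVanishing (K : Type u) [CommRing K] {p : ℕ} (hp : 0 < p) :
    Nonempty {I : PnegaInterfaceV4 K p (emptyProvenance.{u, v} K) // I.NonVanishing} :=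
  ⟨⟨radWitness K hp, radWitness_nonVanishing K hp⟩⟩

end RadWitness

end PnegaInterfaceV4

end Summit.ResolutionOfSingularities.ResolutionOfSingularities.Theorems.Campaign

end
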